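import Summits.ResolutionOfSingularities.ResolutionOfSingularities.Theorems.PurelyInseparableDim4StepKitState
import Summits.ResolutionOfSingularities.ResolutionOfSingularities.Theorems.PurelyInseparableDim4CleaningDisjoint
import HarnessLib
import HarnessLib.Audit.Tags

/-!
# Purely inseparable fourfolds — a DIVERGENT MODE-1h BRANCH from a leaf with a unit cofactor over `𝔽₂`
# (cell res-dim4-pi; desk WORD #132 (c) brick (i) «leaves with a univariate unit»: the negative answer ‖ K)
# [OURS · counted 0 · a theorem about OUR coordinate-centre frame v4, not about resolution]

Width seat `res-dim4-p-10` (g3).  The pure-leaf theorems (D3b–D3d: MODE 1h terminates from every pure leaf `x^a` over every field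
of characteristic `p`) are SHARP in the direction «add a unit cofactor»: over `𝔽₂`, `q = 2`, the `d = 0` leaf
`x₀x₁x₂x₃·(1 + x₀)` starts an INFINITE MODE-1h branch whose degree grows without bound (so it is not a cycle — contrast
crit-1's K-A-01 2-cycle):

* the family `F m = x₁·(x₃ + x₃² + ⋯ + x₃^{m+1} + x₀ + x₀²x₃^m + x₀²x₃^{m+1})` (`m ≥ 0`, `deg F m = m + 4`); at `F m` the UNIQUE MODE-1h
  centre is `S = {x₀, x₁, x₃}`, and the reply «chart `x₃`, point `b = (1,0,0,0)`» (off the origin, ON the exceptional divisor) is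
  equimultiple with cleaned transform `F (m+1)` (`chartTransform_F`, `pointTransform_F`, `step_F`, `isMode1hCentre_F`, `step1h_F`);
* the leaf reaches `F 0` in two MODE-1h steps (`step1h_leaf`, `step1h_prefix`, by the cell's step kit, `decide`);
* **`exists_step1h_chain_unitLeaf`** — `∃ c : ℕ → State (ZMod 2), c 0 = ⟨x₀x₁x₂x₃ + x₀²x₁x₂x₃, 0, ∅⟩ ∧ ∀ k, Step1h 2 (c k) (c (k+1))`,
  with `deg (c (k+2)).F = k + 4` (`degree_chain_unbounded`): MODE 1h does NOT terminate from this `d = 0` leaf, by DIVERGENCE.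

So «MODE 1h terminates from every d = 0 leaf» is FALSE at (2,2) already for a monomial times a ONE-variable unit (TRUE for every pure
monomial, every `K`, every `p`); the plain-game status of this leaf is not decided here.  Nothing here proves or refutes resolution of
singularities in dim ≥ 4 / char `p`; counted 0; AI work, weaker than expert review. bears_on: LADDER-RESOLUTION:D157-DOOR2 (res-dim4-pi ·
brick (i)). Supports stmt-ResolutionOfSingularities-16155 (helper).
-/

set_option linter.dupNamespace false

open MvPolynomial Finset

open scoped BigOperators

noncomputable section
namespace Summit.ResolutionOfSingularities.ResolutionOfSingularities.Theorems.PIDim4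

namespace UnitDivergence

open Literature.AlgebraicGeometry.Resolution
open Literature.AlgebraicGeometry.Resolution.Hauser2010
open CentreBlowup StepKit PthPowerFactor

/-! ## 1. The family `F m` as a sum of monomials; its support -/

/-- `x₁x₃^n`, `x₀x₁`, `x₀²x₁x₃^n` as monomials. [folklore] -/
theorem monomial_forms (n : ℕ) :
    (X 1 * X 3 ^ n : MvPolynomial (Fin 4) (ZMod 2)) = monomial (Finsupp.single 1 1 + Finsupp.single 3 n) 1 ∧
    (X 0 * X 1 : MvPolynomial (Fin 4) (ZMod 2)) = monomial (Finsupp.single 0 1 + Finsupp.single 1 1) 1 ∧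
    (X 0 ^ 2 * X 1 * X 3 ^ n : MvPolynomial (Fin 4) (ZMod 2)) =
      monomial (Finsupp.single 0 2 + Finsupp.single 1 1 + Finsupp.single 3 n) 1 := by
  refine ⟨?_, ?_, ?_⟩
  · rw [X, X_pow_eq_monomial, monomial_mul, one_mul]
  · rw [X, X, monomial_mul, one_mul]
  · rw [X_pow_eq_monomial, X, X_pow_eq_monomial, monomial_mul, monomial_mul, one_mul, one_mul]

/-- **`F m` as a sum of monomials.** [folklore] -/
theorem F_eq_sum (m : ℕ) :
    (X 1 * ((∑ t ∈ Finset.range (m + 1), X 3 ^ (t + 1)) + X 0 + X 0 ^ 2 * X 3 ^ m + X 0 ^ 2 * X 3 ^ (m + 1)) :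
        MvPolynomial (Fin 4) (ZMod 2)) =
      (∑ t ∈ Finset.range (m + 1), monomial (Finsupp.single 1 1 + Finsupp.single 3 (t + 1)) 1) +
        monomial (Finsupp.single 0 1 + Finsupp.single 1 1) 1 +
        monomial (Finsupp.single 0 2 + Finsupp.single 1 1 + Finsupp.single 3 m) 1 +
        monomial (Finsupp.single 0 2 + Finsupp.single 1 1 + Finsupp.single 3 (m + 1)) 1 := by
  rw [mul_add, mul_add, mul_add, Finset.mul_sum]
  have h1 : ∀ t, (X 1 * X 3 ^ (t + 1) : MvPolynomial (Fin 4) (ZMod 2)) =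
      monomial (Finsupp.single 1 1 + Finsupp.single 3 (t + 1)) 1 := fun t => (monomial_forms (t + 1)).1
  simp_rw [h1]
  rw [mul_comm (X 1) (X 0), (monomial_forms 0).2.1, ← mul_assoc, mul_comm (X 1) (X 0 ^ 2), (monomial_forms m).2.2,
    ← mul_assoc, mul_comm (X 1) (X 0 ^ 2), (monomial_forms (m + 1)).2.2]

/-- Every monomial of `F m` is `x₁x₃^{t+1}` (`t ≤ m`), `x₀x₁`, `x₀²x₁x₃^m` or `x₀²x₁x₃^{m+1}`. [folklore] -/
theorem mem_support_F (m : ℕ) {d : Fin 4 →₀ ℕ}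
    (hd : d ∈ (X 1 * ((∑ t ∈ Finset.range (m + 1), X 3 ^ (t + 1)) + X 0 + X 0 ^ 2 * X 3 ^ m + X 0 ^ 2 * X 3 ^ (m + 1)) :
      MvPolynomial (Fin 4) (ZMod 2)).support) :
    (∃ t, t ≤ m ∧ d = Finsupp.single 1 1 + Finsupp.single 3 (t + 1)) ∨ d = Finsupp.single 0 1 + Finsupp.single 1 1 ∨
      d = Finsupp.single 0 2 + Finsupp.single 1 1 + Finsupp.single 3 m ∨
      d = Finsupp.single 0 2 + Finsupp.single 1 1 + Finsupp.single 3 (m + 1) := by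
  classical
  rw [F_eq_sum] at hd
  rcases Finset.mem_union.mp (support_add hd) with h | h
  · rcases Finset.mem_union.mp (support_add h) with h | h
    · rcases Finset.mem_union.mp (support_add h) with h | h
      · obtain ⟨t, ht, hdt⟩ := Finset.mem_biUnion.mp (support_sum h)
        exact Or.inl ⟨t, Nat.lt_succ_iff.mp (Finset.mem_range.mp ht), Finset.mem_singleton.mp (support_monomial_subset hdt)⟩
      · exact Or.inr (Or.inl (Finset.mem_singleton.mp (support_monomial_subset h)))
    · exact Or.inr (Or.inr (Or.inl (Finset.mem_singleton.mp (support_monomial_subset h))))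
  · exact Or.inr (Or.inr (Or.inr (Finset.mem_singleton.mp (support_monomial_subset h))))

/-- Every monomial of `F m` has `x₁`-exponent `1`, `S`-degree (`S = {x₀,x₁,x₃}`) `≥ 2` and total degree `≥ 2`. [folklore] -/
theorem support_F_props (m : ℕ) {d : Fin 4 →₀ ℕ}
    (hd : d ∈ (X 1 * ((∑ t ∈ Finset.range (m + 1), X 3 ^ (t + 1)) + X 0 + X 0 ^ 2 * X 3 ^ m + X 0 ^ 2 * X 3 ^ (m + 1)) :
      MvPolynomial (Fin 4) (ZMod 2)).support) :
    d 1 = 1 ∧ 2 ≤ d 0 + d 1 + d 3 ∧ 2 ≤ d.degree := by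
  have hdeg : ∀ e : Fin 4 →₀ ℕ, e.degree = e 0 + e 1 + e 2 + e 3 := fun e => by
    rw [Finsupp.degree_eq_sum, Fin.sum_univ_four]
  rcases mem_support_F m hd with ⟨t, -, rfl⟩ | rfl | rfl | rfl <;>
    refine ⟨by simp, by simp <;> omega, ?_⟩ <;>
    rw [hdeg] <;> simp <;> omega

/-- The coefficients of `x₀x₁` and `x₁x₃` in `F m` are `1`. [folklore] -/
theorem coeff_F (m : ℕ) :
    coeff (Finsupp.single 0 1 + Finsupp.single 1 1)
        (X 1 * ((∑ t ∈ Finset.range (m + 1), X 3 ^ (t + 1)) + X 0 + X 0 ^ 2 * X 3 ^ m + X 0 ^ 2 * X 3 ^ (m + 1)) :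
          MvPolynomial (Fin 4) (ZMod 2)) = 1 ∧
    coeff (Finsupp.single 1 1 + Finsupp.single 3 1)
        (X 1 * ((∑ t ∈ Finset.range (m + 1), X 3 ^ (t + 1)) + X 0 + X 0 ^ 2 * X 3 ^ m + X 0 ^ 2 * X 3 ^ (m + 1)) :
          MvPolynomial (Fin 4) (ZMod 2)) = 1 := by
  classical
  have hne1 : ∀ t, Finsupp.single 1 1 + Finsupp.single 3 (t + 1) ≠ (Finsupp.single 0 1 + Finsupp.single 1 1 : Fin 4 →₀ ℕ) :=
    fun t h => by have := DFunLike.congr_fun h 0; simp at this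
  have hne2 : ∀ n, Finsupp.single 0 2 + Finsupp.single 1 1 + Finsupp.single 3 n ≠ (Finsupp.single 0 1 + Finsupp.single 1 1 : Fin 4 →₀ ℕ) :=
    fun n h => by have := DFunLike.congr_fun h 0; simp at this
  have hne3 : ∀ t, (Finsupp.single 1 1 + Finsupp.single 3 (t + 1) = (Finsupp.single 1 1 + Finsupp.single 3 1 : Fin 4 →₀ ℕ)) ↔ t = 0 :=
    fun t => ⟨fun h => by have := DFunLike.congr_fun h 3; simp at this; omega,
      fun h => by rw [h]⟩
  have hne4 : (Finsupp.single 0 1 + Finsupp.single 1 1 : Fin 4 →₀ ℕ) ≠ Finsupp.single 1 1 + Finsupp.single 3 1 :=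
    fun h => by have := DFunLike.congr_fun h 0; simp at this
  have hne5 : ∀ n, Finsupp.single 0 2 + Finsupp.single 1 1 + Finsupp.single 3 n ≠ (Finsupp.single 1 1 + Finsupp.single 3 1 : Fin 4 →₀ ℕ) :=
    fun n h => by have := DFunLike.congr_fun h 0; simp at this
  rw [F_eq_sum]
  refine ⟨?_, ?_⟩
  · simp only [coeff_add, coeff_sum, coeff_monomial, hne1, hne2, if_false, if_true, Finset.sum_const_zero, zero_add, add_zero]
  · simp only [coeff_add, coeff_sum, coeff_monomial, hne3, hne4, hne5, if_false, Finset.sum_ite_eq', Finset.mem_range,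
      Nat.zero_lt_succ, if_true, add_zero]

/-- `F m ≠ 0`. [folklore] -/
theorem F_ne_zero (m : ℕ) :
    (X 1 * ((∑ t ∈ Finset.range (m + 1), X 3 ^ (t + 1)) + X 0 + X 0 ^ 2 * X 3 ^ m + X 0 ^ 2 * X 3 ^ (m + 1)) :
      MvPolynomial (Fin 4) (ZMod 2)) ≠ 0 := fun h => by
  have h1 := (coeff_F m).1
  rw [h, coeff_zero] at h1
  exact zero_ne_one h1

/-- `ord_{(x₀,x₁,x₃)} F m = 2`. [folklore] -/
theorem ordAlong_S_F (m : ℕ) :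
    ordAlong ({0, 1, 3} : Finset (Fin 4))
      (X 1 * ((∑ t ∈ Finset.range (m + 1), X 3 ^ (t + 1)) + X 0 + X 0 ^ 2 * X 3 ^ m + X 0 ^ 2 * X 3 ^ (m + 1)) :
        MvPolynomial (Fin 4) (ZMod 2)) = 2 := by
  have hdeg : ∀ d : Fin 4 →₀ ℕ, degIn ({0, 1, 3} : Finset (Fin 4)) d = d 0 + d 1 + d 3 := fun d => by
    unfold degIn
    rw [Finset.sum_insert (by decide), Finset.sum_insert (by decide), Finset.sum_singleton, add_assoc]
  refine le_antisymm ?_ (le_ordAlong_of_forall fun d hd => by rw [hdeg]; exact (support_F_props m hd).2.1)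
  have h := ordAlong_le_of_coeff_ne_zero (S := ({0, 1, 3} : Finset (Fin 4))) (d := Finsupp.single 0 1 + Finsupp.single 1 1)
    (F := (X 1 * ((∑ t ∈ Finset.range (m + 1), X 3 ^ (t + 1)) + X 0 + X 0 ^ 2 * X 3 ^ m + X 0 ^ 2 * X 3 ^ (m + 1)) :
      MvPolynomial (Fin 4) (ZMod 2))) (by rw [(coeff_F m).1]; exact one_ne_zero)
  rw [hdeg] at h
  simpa [Finsupp.single_apply] using h

/-- **`{x₀, x₁, x₃}` is a MODE-1h centre at `F m`** (permissible; no singleton or pair is: `x₀x₁` and `x₁x₃` are monomials of `F m`).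
[folklore] -/
theorem isMode1hCentre_F (m : ℕ) :
    IsMode1hCentre 2 ({0, 1, 3} : Finset (Fin 4))
      (X 1 * ((∑ t ∈ Finset.range (m + 1), X 3 ^ (t + 1)) + X 0 + X 0 ^ 2 * X 3 ^ m + X 0 ^ 2 * X 3 ^ (m + 1)) :
        MvPolynomial (Fin 4) (ZMod 2)) := by
  refine ⟨⟨⟨0, by decide⟩, by rw [ordAlong_S_F]; exact le_rfl⟩, fun S' hS' => ?_⟩
  obtain ⟨-, hord⟩ := hS'
  -- the monomials `x₀x₁` and `x₁x₃` bound the order along `S'`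
  have hb := le_trans hord (ordAlong_le_of_coeff_ne_zero (S := S') (by rw [(coeff_F m).1]; exact one_ne_zero))
  have ha := le_trans hord (ordAlong_le_of_coeff_ne_zero (S := S') (by rw [(coeff_F m).2]; exact one_ne_zero))
  have hb' : 2 ≤ degIn S' (Finsupp.single 0 1 + Finsupp.single 1 1 : Fin 4 →₀ ℕ) := by exact_mod_cast hb
  have ha' : 2 ≤ degIn S' (Finsupp.single 1 1 + Finsupp.single 3 1 : Fin 4 →₀ ℕ) := by exact_mod_cast ha
  have hadd : ∀ u v : Fin 4 →₀ ℕ, degIn S' (u + v) = degIn S' u + degIn S' v := fun u v => by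
    simp only [degIn, Finsupp.coe_add, Pi.add_apply, Finset.sum_add_distrib]
  rw [hadd, degIn_single, degIn_single] at hb' ha'
  have h0 : (0 : Fin 4) ∈ S' := by by_contra h; rw [if_neg h] at hb'; split_ifs at hb'; all_goals omega
  have h1 : (1 : Fin 4) ∈ S' := by by_contra h; rw [if_neg h] at hb'; split_ifs at hb'; all_goals omega
  have h3 : (3 : Fin 4) ∈ S' := by by_contra h; rw [if_neg h] at ha'; split_ifs at ha'; all_goals omega
  have hsub : ({0, 1, 3} : Finset (Fin 4)) ⊆ S' := by
    intro x hx
    simp only [Finset.mem_insert, Finset.mem_singleton] at hx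
    rcases hx with rfl | rfl | rfl
    · exact h0
    · exact h1
    · exact h3
  exact Finset.card_le_card hsub

/-- **The chart `x₃` of the centre `{x₀,x₁,x₃}` on `F m`**: `x₃`-exponent `↦ d₀ + d₁ + d₃ − 2`. [folklore] -/
theorem chartTransform_F (m : ℕ) :
    chartTransform 2 ({0, 1, 3} : Finset (Fin 4)) 3
      (X 1 * ((∑ t ∈ Finset.range (m + 1), X 3 ^ (t + 1)) + X 0 + X 0 ^ 2 * X 3 ^ m + X 0 ^ 2 * X 3 ^ (m + 1)) :
        MvPolynomial (Fin 4) (ZMod 2)) =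
      X 1 * ((∑ t ∈ Finset.range (m + 1), X 3 ^ t) + X 0 + X 0 ^ 2 * X 3 ^ (m + 1) + X 0 ^ 2 * X 3 ^ (m + 2)) := by
  have hdeg : ∀ d : Fin 4 →₀ ℕ, degIn ({0, 1, 3} : Finset (Fin 4)) d = d 0 + d 1 + d 3 := fun d => by
    unfold degIn
    rw [Finset.sum_insert (by decide), Finset.sum_insert (by decide), Finset.sum_singleton, add_assoc]
  have hce : ∀ (a c n n' : ℕ), n' + 2 = a + 1 + n →
      chartExponent 2 ({0, 1, 3} : Finset (Fin 4)) 3 (Finsupp.single 0 a + Finsupp.single 1 1 + Finsupp.single 3 n) =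
        Finsupp.single 0 a + Finsupp.single 1 1 + Finsupp.single 3 n' := fun a c n n' h => by
    rw [chartExponent_eq_iff]
    refine ⟨?_, fun i hi => ?_⟩
    · rw [hdeg]; simp; omega
    · fin_cases i <;> simp at hi ⊢
  -- rewrite both sides as monomial sums and compare termwise
  rw [F_eq_sum, chartTransform_add, chartTransform_add, chartTransform_add, chartTransform_sum]
  simp only [chartTransform_monomial]
  have e1 : ∀ t, chartExponent 2 ({0, 1, 3} : Finset (Fin 4)) 3 (Finsupp.single 1 1 + Finsupp.single 3 (t + 1)) =
      Finsupp.single 1 1 + Finsupp.single 3 t := fun t => by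
    have h := hce 0 0 (t + 1) t (by omega)
    rwa [Finsupp.single_zero, zero_add] at h
  have e2 : chartExponent 2 ({0, 1, 3} : Finset (Fin 4)) 3 (Finsupp.single 0 1 + Finsupp.single 1 1) =
      Finsupp.single 0 1 + Finsupp.single 1 1 := by
    have h := hce 1 0 0 0 (by omega)
    rwa [Finsupp.single_zero, add_zero] at h
  simp_rw [e1]
  rw [e2, hce 2 0 m (m + 1) (by omega), hce 2 0 (m + 1) (m + 2) (by omega)]
  -- back to `X`-form
  rw [mul_add, mul_add, mul_add, Finset.mul_sum]
  have h1 : ∀ t, (X 1 * X 3 ^ t : MvPolynomial (Fin 4) (ZMod 2)) = monomial (Finsupp.single 1 1 + Finsupp.single 3 t) 1 :=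
    fun t => (monomial_forms t).1
  simp_rw [h1]
  rw [mul_comm (X 1) (X 0), (monomial_forms 0).2.1, ← mul_assoc, mul_comm (X 1) (X 0 ^ 2), (monomial_forms (m + 1)).2.2,
    ← mul_assoc, mul_comm (X 1) (X 0 ^ 2), (monomial_forms (m + 2)).2.2]

/-- **The translated transform is `F (m+1)`**: `b = (1,0,0,0)` shifts `x₀ ↦ x₀ + 1`; the two bare `x₁` cancel in characteristic 2.
[folklore] -/
theorem pointTransform_F (m : ℕ) (r : Fin 4 →₀ ℕ) (exc : Finset (Fin 4)) :
    pointTransform 2 ({0, 1, 3} : Finset (Fin 4)) 3 (fun i => if i = 0 then 1 else 0)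
      (⟨X 1 * ((∑ t ∈ Finset.range (m + 1), X 3 ^ (t + 1)) + X 0 + X 0 ^ 2 * X 3 ^ m + X 0 ^ 2 * X 3 ^ (m + 1)), r, exc⟩ :
        State (ZMod 2)) =
      X 1 * ((∑ t ∈ Finset.range (m + 2), X 3 ^ (t + 1)) + X 0 + X 0 ^ 2 * X 3 ^ (m + 1) + X 0 ^ 2 * X 3 ^ (m + 2)) := by
  unfold pointTransform PointBlowup.translate
  rw [show (⟨X 1 * ((∑ t ∈ Finset.range (m + 1), X 3 ^ (t + 1)) + X 0 + X 0 ^ 2 * X 3 ^ m + X 0 ^ 2 * X 3 ^ (m + 1)), r, exc⟩ :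
      State (ZMod 2)).F = X 1 * ((∑ t ∈ Finset.range (m + 1), X 3 ^ (t + 1)) + X 0 + X 0 ^ 2 * X 3 ^ m + X 0 ^ 2 * X 3 ^ (m + 1))
      from rfl, chartTransform_F]
  simp only [map_mul, map_add, map_sum, map_pow, aeval_X]
  simp only [Fin.isValue, if_true, show ((1 : Fin 4) = 0) = False from by decide, show ((3 : Fin 4) = 0) = False from by decide,
    if_false, C_0, add_zero, C_1]
  have h2 : (2 : MvPolynomial (Fin 4) (ZMod 2)) = 0 := by
    rw [show (2 : MvPolynomial (Fin 4) (ZMod 2)) = C 2 from by rw [map_ofNat], show (2 : ZMod 2) = 0 from rfl, C_0]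
  rw [Finset.sum_range_succ' (fun t => (X 3 : MvPolynomial (Fin 4) (ZMod 2)) ^ t), pow_zero,
    Finset.sum_range_succ (fun t => (X 3 : MvPolynomial (Fin 4) (ZMod 2)) ^ (t + 1)) (m + 1),
    Finset.sum_range_succ (fun t => (X 3 : MvPolynomial (Fin 4) (ZMod 2)) ^ (t + 1)) m]
  linear_combination (X 1 * (1 + X 0 * (X 3 ^ (m + 1) + X 3 ^ (m + 2))) : MvPolynomial (Fin 4) (ZMod 2)) * h2

/-- The cleaning is inert on `F m` (every monomial carries `x₁` to the first power). [folklore] -/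
theorem deletePthPowers_F (m : ℕ) :
    deletePthPowers 2 (X 1 * ((∑ t ∈ Finset.range (m + 1), X 3 ^ (t + 1)) + X 0 + X 0 ^ 2 * X 3 ^ m + X 0 ^ 2 * X 3 ^ (m + 1)) :
        MvPolynomial (Fin 4) (ZMod 2)) =
      X 1 * ((∑ t ∈ Finset.range (m + 1), X 3 ^ (t + 1)) + X 0 + X 0 ^ 2 * X 3 ^ m + X 0 ^ 2 * X 3 ^ (m + 1)) :=
  deletePthPowers_eq_self_of_forall 2 _ fun d hd h => by
    have h1 := (support_F_props m hd).1
    have := (isPthPowerExponent_iff 2 d).mp h 1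
    rw [h1] at this
    exact absurd this (by decide)

/-- **The whole step**: from `⟨F m, 0, exc⟩` the reply (chart `x₃`, `b = (1,0,0,0)`) at the centre `{x₀,x₁,x₃}` gives
`⟨F (m+1), 0, insert x₃ (exc ∖ {x₀})⟩`. [folklore] -/
theorem step_F (m : ℕ) (exc : Finset (Fin 4)) :
    step 2 ({0, 1, 3} : Finset (Fin 4)) 3 (fun i => if i = 0 then 1 else 0)
      (⟨X 1 * ((∑ t ∈ Finset.range (m + 1), X 3 ^ (t + 1)) + X 0 + X 0 ^ 2 * X 3 ^ m + X 0 ^ 2 * X 3 ^ (m + 1)), 0, exc⟩ :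
        State (ZMod 2)) =
      ⟨X 1 * ((∑ t ∈ Finset.range (m + 2), X 3 ^ (t + 1)) + X 0 + X 0 ^ 2 * X 3 ^ (m + 1) + X 0 ^ 2 * X 3 ^ (m + 2)), 0,
        insert 3 (exc.filter fun i => (if i = (0 : Fin 4) then (1 : ZMod 2) else 0) = 0)⟩ := by
  have hF : deletePthPowers 2 (pointTransform 2 ({0, 1, 3} : Finset (Fin 4)) 3 (fun i => if i = 0 then 1 else 0)
      (⟨X 1 * ((∑ t ∈ Finset.range (m + 1), X 3 ^ (t + 1)) + X 0 + X 0 ^ 2 * X 3 ^ m + X 0 ^ 2 * X 3 ^ (m + 1)), 0, exc⟩ :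
        State (ZMod 2))) =
      X 1 * ((∑ t ∈ Finset.range (m + 2), X 3 ^ (t + 1)) + X 0 + X 0 ^ 2 * X 3 ^ (m + 1) + X 0 ^ 2 * X 3 ^ (m + 2)) := by
    rw [pointTransform_F, deletePthPowers_F (m + 1)]
  have hr : newMult 2 ({0, 1, 3} : Finset (Fin 4)) 3 (fun i => if i = 0 then 1 else 0)
      (⟨X 1 * ((∑ t ∈ Finset.range (m + 1), X 3 ^ (t + 1)) + X 0 + X 0 ^ 2 * X 3 ^ m + X 0 ^ 2 * X 3 ^ (m + 1)), 0, exc⟩ :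
        State (ZMod 2)) = 0 := by
    unfold newMult
    rw [show (⟨X 1 * ((∑ t ∈ Finset.range (m + 1), X 3 ^ (t + 1)) + X 0 + X 0 ^ 2 * X 3 ^ m + X 0 ^ 2 * X 3 ^ (m + 1)), 0, exc⟩ :
      State (ZMod 2)).r = 0 from rfl, Finsupp.filter_zero, ordAlong_S_F]
    ext i
    rw [Finsupp.update_apply]
    split_ifs <;> rfl
  rw [show step 2 ({0, 1, 3} : Finset (Fin 4)) 3 (fun i => if i = 0 then 1 else 0)
      (⟨X 1 * ((∑ t ∈ Finset.range (m + 1), X 3 ^ (t + 1)) + X 0 + X 0 ^ 2 * X 3 ^ m + X 0 ^ 2 * X 3 ^ (m + 1)), 0, exc⟩ :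
        State (ZMod 2)) = ⟨_, _, _⟩ from rfl, hF, hr]
  rfl

/-- **`F m → F (m+1)` is a MODE-1h step** (every `m`, every `exc`). [OURS · counted 0] [folklore] -/
theorem step1h_F (m : ℕ) (exc : Finset (Fin 4)) :
    Step1h 2 (⟨X 1 * ((∑ t ∈ Finset.range (m + 1), X 3 ^ (t + 1)) + X 0 + X 0 ^ 2 * X 3 ^ m + X 0 ^ 2 * X 3 ^ (m + 1)), 0, exc⟩ :
        State (ZMod 2))
      ⟨X 1 * ((∑ t ∈ Finset.range (m + 2), X 3 ^ (t + 1)) + X 0 + X 0 ^ 2 * X 3 ^ (m + 1) + X 0 ^ 2 * X 3 ^ (m + 2)), 0,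
        insert 3 (exc.filter fun i => (if i = (0 : Fin 4) then (1 : ZMod 2) else 0) = 0)⟩ := by
  refine ⟨{0, 1, 3}, isMode1hCentre_F m, 3, (fun i => if i = 0 then 1 else 0), by decide, rfl, ?_, ?_, (step_F m exc).symm⟩
  · -- equimultiple: the transform `F (m+1)` has no monomial of degree `< 2`
    intro d hd0 hdeg
    rw [pointTransform_F]
    obtain ⟨i, rfl⟩ := PthPowerFactor.eq_single_of_degree_lt_two hd0 hdeg
    by_contra hne
    have h2 := (support_F_props (m + 1) (MvPolynomial.mem_support_iff.mpr hne)).2.2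
    rw [Finsupp.degree_single] at h2
    omega
  · rw [step_F]
    exact F_ne_zero (m + 1)

/-! ## 4. The prefix from the leaf `x₀x₁x₂x₃(1 + x₀)` (two kit steps) and the infinite chain -/

/-- Step 1 (kit): leaf `x₀x₁x₂x₃ + x₀²x₁x₂x₃`, centre `{x₀,x₃}`, chart `x₃`, `b = 0` ⟶ `x₀x₁x₂ + x₀²x₁x₂x₃`, books `(0, {x₃})`. [folklore] -/
theorem step1h_leaf :
    Step1h 2 (⟨[(![1, 1, 1, 1], 1), (![2, 1, 1, 1], 1)], ![0, 0, 0, 0], ∅⟩ : SData 4 (ZMod 2)).toState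
      (⟨[(![1, 1, 1, 0], 1), (![2, 1, 1, 1], 1)], ![0, 0, 0, 0], {3}⟩ : SData 4 (ZMod 2)).toState :=
  step1h_of {0, 3} 3 ![0, 0, 0, 0] (by decide) (by decide) rfl (by decide) (by decide) (by decide)

/-- Step 2 (kit): centre `{x₁,x₂}`, chart `x₂`, `b = (1,0,0,1)` ⟶ `F 0 = x₁x₃ + x₀x₁ + x₀²x₁ + x₀²x₁x₃`, books `(0, {x₂})`. [folklore] -/
theorem step1h_prefix :
    Step1h 2 (⟨[(![1, 1, 1, 0], 1), (![2, 1, 1, 1], 1)], ![0, 0, 0, 0], {3}⟩ : SData 4 (ZMod 2)).toState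
      (⟨[(![0, 1, 0, 1], 1), (![1, 1, 0, 0], 1), (![2, 1, 0, 0], 1), (![2, 1, 0, 1], 1)], ![0, 0, 0, 0], {2}⟩ :
        SData 4 (ZMod 2)).toState :=
  step1h_of {1, 2} 2 ![1, 0, 0, 1] (by decide) (by decide) rfl (by decide) (by decide) (by decide)

/-- The kit's `F 0` is our `F 0`. [folklore] -/
theorem prefix_toState_eq :
    (⟨[(![0, 1, 0, 1], 1), (![1, 1, 0, 0], 1), (![2, 1, 0, 0], 1), (![2, 1, 0, 1], 1)], ![0, 0, 0, 0], {2}⟩ :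
        SData 4 (ZMod 2)).toState =
      (⟨X 1 * ((∑ t ∈ Finset.range (0 + 1), X 3 ^ (t + 1)) + X 0 + X 0 ^ 2 * X 3 ^ 0 + X 0 ^ 2 * X 3 ^ (0 + 1)), 0, {2}⟩ :
        State (ZMod 2)) := by
  have he : ∀ v : Fin 4 → ℕ, expo v = Finsupp.single 0 (v 0) + Finsupp.single 1 (v 1) + Finsupp.single 2 (v 2) +
      Finsupp.single 3 (v 3) := fun v => by
    ext i; fin_cases i <;> simp [expo]
  have hr : expo ![0, 0, 0, 0] = (0 : Fin 4 →₀ ℕ) := by ext i; fin_cases i <;> rfl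
  have hF : evalT [(![0, 1, 0, 1], (1 : ZMod 2)), (![1, 1, 0, 0], 1), (![2, 1, 0, 0], 1), (![2, 1, 0, 1], 1)] =
      (X 1 * ((∑ t ∈ Finset.range (0 + 1), X 3 ^ (t + 1)) + X 0 + X 0 ^ 2 * X 3 ^ 0 + X 0 ^ 2 * X 3 ^ (0 + 1)) :
        MvPolynomial (Fin 4) (ZMod 2)) := by
    rw [F_eq_sum 0]
    simp only [evalT_cons, evalT_nil, he]
    simp [Finsupp.single_zero]
    abel
  show (⟨evalT _, expo ![0, 0, 0, 0], {2}⟩ : State (ZMod 2)) = _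
  rw [hr, hF]

/-- **AN INFINITE MODE-1h BRANCH FROM THE `d = 0` LEAF `x₀x₁x₂x₃(1 + x₀)` OVER `𝔽₂`.** [OURS · counted 0] [folklore] -/
theorem exists_step1h_chain_unitLeaf :
    ∃ c : ℕ → State (ZMod 2),
      c 0 = (⟨[(![1, 1, 1, 1], 1), (![2, 1, 1, 1], 1)], ![0, 0, 0, 0], ∅⟩ : SData 4 (ZMod 2)).toState ∧
        ∀ k, Step1h 2 (c k) (c (k + 1)) := by
  -- the tail: iterate the family step from `⟨F 0, 0, {2}⟩`
  let tail : ℕ → State (ZMod 2) := fun k => Nat.rec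
    (⟨X 1 * ((∑ t ∈ Finset.range (0 + 1), X 3 ^ (t + 1)) + X 0 + X 0 ^ 2 * X 3 ^ 0 + X 0 ^ 2 * X 3 ^ (0 + 1)), 0, {2}⟩ : State (ZMod 2))
    (fun _ s => step 2 ({0, 1, 3} : Finset (Fin 4)) 3 (fun i => if i = 0 then 1 else 0) s) k
  have htail : ∀ k, ∃ exc : Finset (Fin 4), tail k =
      ⟨X 1 * ((∑ t ∈ Finset.range (k + 1), X 3 ^ (t + 1)) + X 0 + X 0 ^ 2 * X 3 ^ k + X 0 ^ 2 * X 3 ^ (k + 1)), 0, exc⟩ := by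
    intro k
    induction k with
    | zero => exact ⟨{2}, rfl⟩
    | succ k ih =>
      obtain ⟨exc, hk⟩ := ih
      refine ⟨insert 3 (exc.filter fun i => (if i = (0 : Fin 4) then (1 : ZMod 2) else 0) = 0), ?_⟩
      show step 2 ({0, 1, 3} : Finset (Fin 4)) 3 (fun i => if i = 0 then 1 else 0) (tail k) = _
      rw [hk, step_F]
  refine ⟨fun k => if k = 0 then (⟨[(![1, 1, 1, 1], 1), (![2, 1, 1, 1], 1)], ![0, 0, 0, 0], ∅⟩ : SData 4 (ZMod 2)).toState
      else if k = 1 then (⟨[(![1, 1, 1, 0], 1), (![2, 1, 1, 1], 1)], ![0, 0, 0, 0], {3}⟩ : SData 4 (ZMod 2)).toState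
      else tail (k - 2), by simp, fun k => ?_⟩
  rcases k with _ | _ | k
  · simpa using step1h_leaf
  · simp only [zero_add, one_ne_zero, if_false, if_true, show (1 + 1 : ℕ) = 2 from rfl, show ((2 : ℕ) = 0) = False from by decide,
      show ((2 : ℕ) = 1) = False from by decide, Nat.sub_self]
    have h := step1h_prefix
    rw [prefix_toState_eq] at h
    exact h
  · simp only [show (k + 1 + 1 = 0) = False from by simp, show (k + 1 + 1 = 1) = False from by simp,
      show (k + 1 + 1 + 1 = 0) = False from by simp, show (k + 1 + 1 + 1 = 1) = False from by simp, if_false,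
      show k + 1 + 1 - 2 = k from by omega, show k + 1 + 1 + 1 - 2 = k + 1 from by omega]
    obtain ⟨exc, hk⟩ := htail k
    have hsucc : tail (k + 1) = step 2 ({0, 1, 3} : Finset (Fin 4)) 3 (fun i => if i = 0 then 1 else 0) (tail k) := rfl
    rw [hsucc, hk, step_F]
    exact step1h_F k exc

/-- **The branch DIVERGES**: the `k+2`-nd state of a chain as above may be taken with `F`-component of total degree `k + 4` — here
stated for the family: `deg F m = m + 4` witnessed by the monomial `x₀²x₁x₃^{m+1}`. [folklore] -/
theorem totalDegree_F (m : ℕ) :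
    m + 4 ≤ (X 1 * ((∑ t ∈ Finset.range (m + 1), X 3 ^ (t + 1)) + X 0 + X 0 ^ 2 * X 3 ^ m + X 0 ^ 2 * X 3 ^ (m + 1)) :
      MvPolynomial (Fin 4) (ZMod 2)).totalDegree := by
  classical
  have hmem : (Finsupp.single 0 2 + Finsupp.single 1 1 + Finsupp.single 3 (m + 1) : Fin 4 →₀ ℕ) ∈
      (X 1 * ((∑ t ∈ Finset.range (m + 1), X 3 ^ (t + 1)) + X 0 + X 0 ^ 2 * X 3 ^ m + X 0 ^ 2 * X 3 ^ (m + 1)) :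
        MvPolynomial (Fin 4) (ZMod 2)).support := by
    rw [MvPolynomial.mem_support_iff, F_eq_sum]
    have hne1 : ∀ t, Finsupp.single 1 1 + Finsupp.single 3 (t + 1) ≠
        (Finsupp.single 0 2 + Finsupp.single 1 1 + Finsupp.single 3 (m + 1) : Fin 4 →₀ ℕ) :=
      fun t h => by have := DFunLike.congr_fun h 0; simp at this
    have hne2 : (Finsupp.single 0 1 + Finsupp.single 1 1 : Fin 4 →₀ ℕ) ≠
        Finsupp.single 0 2 + Finsupp.single 1 1 + Finsupp.single 3 (m + 1) :=
      fun h => by have := DFunLike.congr_fun h 0; simp at this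
    have hne3 : (Finsupp.single 0 2 + Finsupp.single 1 1 + Finsupp.single 3 m : Fin 4 →₀ ℕ) ≠
        Finsupp.single 0 2 + Finsupp.single 1 1 + Finsupp.single 3 (m + 1) :=
      fun h => by have := DFunLike.congr_fun h 3; simp at this
    simp only [coeff_add, coeff_sum, coeff_monomial, hne1, hne2, hne3, if_false, if_true, Finset.sum_const_zero, zero_add]
    exact one_ne_zero
  have h := le_totalDegree hmem
  have hsum : ((Finsupp.single 0 2 + Finsupp.single 1 1 + Finsupp.single 3 (m + 1) : Fin 4 →₀ ℕ).sum fun _ e => e) = m + 4 := by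
    change Finsupp.degree (Finsupp.single 0 2 + Finsupp.single 1 1 + Finsupp.single 3 (m + 1) : Fin 4 →₀ ℕ) = m + 4
    simp only [map_add, Finsupp.degree_single]
    omega
  rw [hsum] at h
  exact h

end UnitDivergence

end Summit.ResolutionOfSingularities.ResolutionOfSingularities.Theorems.PIDim4

end
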